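import Mathlib
import HarnessLib
import Summits.QuantumFields.YangMills.Theses.PencilRigidity
import Summits.QuantumFields.YangMills.Theorems.PencilRigidityKernelTransferApprox

/-!
# `KernelTransfer` — pointwise reflection positivity and hermiticity of the kernel (support for stmt-QuantumFields-11688)

Support file 2/3 for the item `PencilRigidity.KernelTransfer` (stmt-QuantumFields-11688).  From
the two-point representation `𝔖₂ = ∫ K(x₀ - x₁)·` on `⁰𝒮` (real `K`, continuous off `0`) and
reflection positivity (E2) of the family `𝔖`:

* `kernel_pos_of_isReflectionPositive` — pointwise OS-positivity of `K` across `x₀ = 0`: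
  `∑ᵢⱼ cᵢ cⱼ K(θxᵢ - xⱼ) ≥ 0` for points of positive time (E2 on the one-point terms
  `cⱼ φ_ε(· - xⱼ)` with normalised bumps `φ_ε`, and `ε → 0` by continuity of `K` at
  `θxᵢ - xⱼ ≠ 0`);
* `kernel_theta_symm_of_isReflectionPositive` — hermiticity of the E2 form at kernel level,
  `K(θa - b) = K(θb - a)` for `a⁰, b⁰ > 0` (E2 on the two terms `φ_a`, `i φ_b`).

Sources: Osterwalder–Schrader 1973 §3 (E2); Glimm–Jaffe 1987 §6.1. [folklore]
-/

noncomputable section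

open scoped BigOperators Topology SchwartzMap ComplexConjugate
open MeasureTheory Filter Set
open Literature.MathematicalPhysics.QuantumLattice Literature.MathematicalPhysics.AQFT

namespace Summit.QuantumFields.YangMills.Theorems.KernelTransfer

/-! ## Pointwise OS-positivity of the kernel across `x₀ = 0` -/

/-- **Pointwise reflection positivity of the kernel.** If `𝔖₂ = ∫ K(x₀ - x₁)·` on `⁰𝒮` with `K`
continuous off `0` and the family `𝔖` is reflection positive (E2), then for all points
`x₁, …, x_m` of positive time and real coefficients `c`,
`∑ᵢⱼ cᵢ cⱼ K(θxᵢ - xⱼ) ≥ 0`: E2 on the one-point terms `F_j = c_j φ_ε(· - x_j)` and the limit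
`ε → 0` by continuity of `K` at `θxᵢ - xⱼ ≠ 0`. [folklore] -/
theorem kernel_pos_of_isReflectionPositive {S : SchwingerFamily (EuclideanSpace ℝ (Fin 4))} {K : (EuclideanSpace ℝ (Fin 4)) → ℝ}
    (hK : ContinuousOn K {x : (EuclideanSpace ℝ (Fin 4)) | x ≠ 0})
    (hrep : ∀ F : 𝓢((Fin 2 → (EuclideanSpace ℝ (Fin 4))), ℂ), IsOffDiagonal F →
      Integrable (fun x : Fin 2 → (EuclideanSpace ℝ (Fin 4)) => (K (x 0 - x 1) : ℂ) * F x) ∧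
        S 2 F = ∫ x : Fin 2 → (EuclideanSpace ℝ (Fin 4)), (K (x 0 - x 1) : ℂ) * F x)
    (hRP : S.toLabelled.IsReflectionPositive)
    (m : ℕ) (x : Fin m → (EuclideanSpace ℝ (Fin 4))) (c : Fin m → ℝ) (hx : ∀ i, 0 < x i 0) :
    0 ≤ ∑ i, ∑ j, c i * c j * K (timeReflection 4 (x i) - x j) := by
  set P : Fin m → Fin m → (EuclideanSpace ℝ (Fin 4)) := fun i j => timeReflection 4 (x i) - x j with hP
  -- it suffices to bound the sum below by `-ε` for every `ε > 0`
  suffices h : ∀ ε : ℝ, 0 < ε → -ε ≤ ∑ i, ∑ j, c i * c j * K (P i j) by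
    by_contra hneg
    have hlt : ∑ i, ∑ j, c i * c j * K (P i j) < 0 := lt_of_not_ge hneg
    have := h (-(∑ i, ∑ j, c i * c j * K (P i j)) / 2) (by linarith)
    linarith
  intro ε hε
  set Cabs : ℝ := ∑ i, ∑ j, |c i| * |c j| with hCabs
  have hCabs0 : 0 ≤ Cabs :=
    Finset.sum_nonneg fun i _ => Finset.sum_nonneg fun j _ => by positivity
  set δ : ℝ := ε / (Cabs + 1) with hδ
  have hδ0 : 0 < δ := div_pos hε (by linarith)
  have hδC : Cabs * δ ≤ ε := by
    have h1 : δ * (Cabs + 1) = ε := div_mul_cancel₀ _ (by linarith)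
    nlinarith
  -- continuity of `K` at the points `P i j ≠ 0`
  have hPne : ∀ i j, P i j ≠ 0 := by
    intro i j h
    have h0 : (timeReflection 4 (x i) - x j) 0 = (0 : (EuclideanSpace ℝ (Fin 4))) 0 := by
      rw [show timeReflection 4 (x i) - x j = P i j from rfl, h]
    rw [PiLp.sub_apply, timeReflection_apply, if_pos rfl, PiLp.zero_apply] at h0
    linarith [hx i, hx j]
  have hcont : ∀ i j, ∃ ρ : ℝ, 0 < ρ ∧ ∀ z, dist z (P i j) < ρ → |K z - K (P i j)| ≤ δ := by
    intro i j
    have hca : ContinuousAt K (P i j) :=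
      (hK (P i j) (hPne i j)).continuousAt (isOpen_compl_singleton.mem_nhds (hPne i j))
    obtain ⟨ρ, hρ, h⟩ := Metric.continuousAt_iff.1 hca δ hδ0
    refine ⟨ρ, hρ, fun z hz => ?_⟩
    have := h hz
    rw [Real.dist_eq] at this
    exact this.le
  choose ρ hρ hρK using hcont
  -- one radius for all the bumps
  have ev1 : ∀ᶠ r in 𝓝[>] (0 : ℝ), ∀ i, r < x i 0 :=
    eventually_all.2 fun i => (eventually_lt_nhds (hx i)).filter_mono nhdsWithin_le_nhds
  have ev2 : ∀ᶠ r in 𝓝[>] (0 : ℝ), ∀ i j, r + r < ρ i j :=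
    eventually_all.2 fun i => eventually_all.2 fun j =>
      ((eventually_lt_nhds (half_pos (hρ i j))).filter_mono nhdsWithin_le_nhds).mono
        fun r hr => by linarith
  have ev3 : ∀ᶠ r in 𝓝[>] (0 : ℝ), 0 < r := eventually_mem_nhdsWithin
  obtain ⟨r, hr0, hr1, hr2⟩ := (ev3.and (ev1.and ev2)).exists
  -- normalised bumps at the points `x i`
  choose β φ hβc hβ0 hβ1 hβsupp hφ hφT using fun i => exists_onePoint_bump (x i) hr0 (hr1 i)
  -- the one-point terms of E2 and their witnesses
  set F : Fin m → 𝓢((Fin 1 → (EuclideanSpace ℝ (Fin 4))), ℂ) := fun i => ((c i : ℝ) : ℂ) • φ i with hF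
  have hFT : ∀ i, IsTimeOrdered (F i) := fun i =>
    (tsupport_smul_subset_right (fun _ : Fin 1 → (EuclideanSpace ℝ (Fin 4)) => ((c i : ℝ) : ℂ))
      (φ i : (Fin 1 → (EuclideanSpace ℝ (Fin 4))) → ℂ)).trans (hφT i)
  have key := hRP m (fun _ => 1) (fun _ _ => ()) F hFT
    (fun i j => SchwartzMap.appendTensor (osAdjoint (F i)) (F j))
    (fun i j => isAppendTensorOf_appendTensor _ _)
  obtain ⟨hre, -⟩ := key
  simp only [SchwingerFamily.toLabelled_apply] at hre
  have hre' : 0 ≤ (∑ i, ∑ j, S 2 (SchwartzMap.appendTensor (osAdjoint (F i)) (F j))).re := hre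
  -- each pair is within `|cᵢ cⱼ| δ` of `cᵢ cⱼ K(P i j)`
  have hpair : ∀ i j, |(S 2 (SchwartzMap.appendTensor (osAdjoint (F i)) (F j))).re -
      c i * c j * K (P i j)| ≤ |c i| * |c j| * δ := by
    intro i j
    have hH0 : ∀ y : Fin 2 → (EuclideanSpace ℝ (Fin 4)), SchwartzMap.appendTensor (osAdjoint (φ i)) (φ j) y =
        ((β i (timeReflection 4 (y 0)) * β j (y 1) : ℝ) : ℂ) := fun y => osPair_apply (hφ i) (hφ j) y
    obtain ⟨h1, -⟩ := osPair_twoPoint hrep (hr1 i) (hr1 j) (hβ0 i) (hβ0 j) (hβ1 i) (hβ1 j)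
      (hβsupp i) (hβsupp j) (fun z hz => hρK i j z (lt_trans hz (hr2 i j))) hH0
    have hscale : SchwartzMap.appendTensor (osAdjoint (F i)) (F j) =
        ((c i * c j : ℝ) : ℂ) • SchwartzMap.appendTensor (osAdjoint (φ i)) (φ j) := by
      ext y
      simp only [hF, SchwartzMap.appendTensor_apply, osAdjoint_apply, smul_apply, smul_eq_mul,
        map_mul, Complex.conj_ofReal]
      push_cast
      ring
    rw [hscale, map_smul, smul_eq_mul, Complex.re_ofReal_mul,
      show c i * c j * (S 2 (SchwartzMap.appendTensor (osAdjoint (φ i)) (φ j))).re -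
          c i * c j * K (P i j) =
        (c i * c j) * ((S 2 (SchwartzMap.appendTensor (osAdjoint (φ i)) (φ j))).re - K (P i j)) by
        ring,
      abs_mul, abs_mul]
    exact mul_le_mul_of_nonneg_left h1 (by positivity)
  -- summing up
  have hsum : (∑ i, ∑ j, S 2 (SchwartzMap.appendTensor (osAdjoint (F i)) (F j))).re =
      ∑ i, ∑ j, (S 2 (SchwartzMap.appendTensor (osAdjoint (F i)) (F j))).re := by
    rw [Complex.re_sum]
    exact Finset.sum_congr rfl fun i _ => Complex.re_sum _ _
  rw [hsum] at hre'
  have hdiff : |(∑ i, ∑ j, (S 2 (SchwartzMap.appendTensor (osAdjoint (F i)) (F j))).re) -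
      ∑ i, ∑ j, c i * c j * K (P i j)| ≤ Cabs * δ := by
    rw [← Finset.sum_sub_distrib]
    calc |∑ i, ((∑ j, (S 2 (SchwartzMap.appendTensor (osAdjoint (F i)) (F j))).re) -
            ∑ j, c i * c j * K (P i j))|
        ≤ ∑ i, |(∑ j, (S 2 (SchwartzMap.appendTensor (osAdjoint (F i)) (F j))).re) -
            ∑ j, c i * c j * K (P i j)| := Finset.abs_sum_le_sum_abs _ _
      _ ≤ ∑ i, ∑ j, |c i| * |c j| * δ := by
          refine Finset.sum_le_sum fun i _ => ?_
          rw [← Finset.sum_sub_distrib]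
          exact (Finset.abs_sum_le_sum_abs _ _).trans (Finset.sum_le_sum fun j _ => hpair i j)
      _ = Cabs * δ := by
          rw [hCabs, Finset.sum_mul]
          exact Finset.sum_congr rfl fun i _ => by rw [Finset.sum_mul]
  have h := (abs_le.1 hdiff).2
  linarith

/-! ## Hermiticity of the E2 form: `K(θa - b) = K(θb - a)` -/

/-- **Hermiticity of the E2 form on the kernel.** If `𝔖₂ = ∫ K(x₀ - x₁)·` on `⁰𝒮` with `K`
real and continuous off `0`, and `𝔖` is reflection positive, then `K(θa - b) = K(θb - a)` for
all points `a, b` of positive time: E2 on the two terms `φ_a`, `i φ_b` (bumps at `a`, `b`) says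
that the imaginary part `∫Kψ_{ab} - ∫Kψ_{ba}` of the E2 sum vanishes, and the two integrals
concentrate at `K(θa - b)`, `K(θb - a)`. [folklore] -/
theorem kernel_theta_symm_of_isReflectionPositive {S : SchwingerFamily (EuclideanSpace ℝ (Fin 4))} {K : (EuclideanSpace ℝ (Fin 4)) → ℝ}
    (hK : ContinuousOn K {x : (EuclideanSpace ℝ (Fin 4)) | x ≠ 0})
    (hrep : ∀ F : 𝓢((Fin 2 → (EuclideanSpace ℝ (Fin 4))), ℂ), IsOffDiagonal F →
      Integrable (fun x : Fin 2 → (EuclideanSpace ℝ (Fin 4)) => (K (x 0 - x 1) : ℂ) * F x) ∧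
        S 2 F = ∫ x : Fin 2 → (EuclideanSpace ℝ (Fin 4)), (K (x 0 - x 1) : ℂ) * F x)
    (hRP : S.toLabelled.IsReflectionPositive)
    (a b : (EuclideanSpace ℝ (Fin 4))) (ha : 0 < a 0) (hb : 0 < b 0) :
    K (timeReflection 4 a - b) = K (timeReflection 4 b - a) := by
  -- the two points are off the origin
  have hne : ∀ (u v : (EuclideanSpace ℝ (Fin 4))), 0 < u 0 → 0 < v 0 → timeReflection 4 u - v ≠ 0 := by
    intro u v hu hv h
    have h0 : (timeReflection 4 u - v) 0 = (0 : (EuclideanSpace ℝ (Fin 4))) 0 := by rw [h]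
    rw [PiLp.sub_apply, timeReflection_apply, if_pos rfl, PiLp.zero_apply] at h0
    linarith
  -- it suffices to show `|K(θa - b) - K(θb - a)| ≤ δ` for every `δ > 0`
  refine eq_of_forall_dist_le fun δ hδ => ?_
  rw [Real.dist_eq]
  have hcont : ∀ (u v : (EuclideanSpace ℝ (Fin 4))), 0 < u 0 → 0 < v 0 → ∃ ρ : ℝ, 0 < ρ ∧
      ∀ z, dist z (timeReflection 4 u - v) < ρ → |K z - K (timeReflection 4 u - v)| ≤ δ / 2 := by
    intro u v hu hv
    have hca : ContinuousAt K (timeReflection 4 u - v) :=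
      (hK _ (hne u v hu hv)).continuousAt (isOpen_compl_singleton.mem_nhds (hne u v hu hv))
    obtain ⟨ρ, hρ, h⟩ := Metric.continuousAt_iff.1 hca (δ / 2) (half_pos hδ)
    refine ⟨ρ, hρ, fun z hz => ?_⟩
    have := h hz
    rw [Real.dist_eq] at this
    exact this.le
  obtain ⟨ρ₁, hρ₁, hK₁⟩ := hcont a b ha hb
  obtain ⟨ρ₂, hρ₂, hK₂⟩ := hcont b a hb ha
  -- a common radius
  set r : ℝ := min (min (ρ₁ / 4) (ρ₂ / 4)) (min (a 0 / 2) (b 0 / 2)) with hr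
  have hr0 : 0 < r := lt_min (lt_min (by linarith) (by linarith)) (lt_min (by linarith) (by linarith))
  have hr1 : r + r < ρ₁ := by
    have : r ≤ ρ₁ / 4 := (min_le_left _ _).trans (min_le_left _ _)
    linarith
  have hr2 : r + r < ρ₂ := by
    have : r ≤ ρ₂ / 4 := (min_le_left _ _).trans (min_le_right _ _)
    linarith
  have hra : r < a 0 := by
    have : r ≤ a 0 / 2 := (min_le_right _ _).trans (min_le_left _ _)
    linarith
  have hrb : r < b 0 := by
    have : r ≤ b 0 / 2 := (min_le_right _ _).trans (min_le_right _ _)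
    linarith
  obtain ⟨βa, φa, -, hβa0, hβa1, hβas, hφa, hφaT⟩ := exists_onePoint_bump a hr0 hra
  obtain ⟨βb, φb, -, hβb0, hβb1, hβbs, hφb, hφbT⟩ := exists_onePoint_bump b hr0 hrb
  -- E2 on the two terms `φa`, `I • φb`
  set F : Fin 2 → 𝓢((Fin 1 → (EuclideanSpace ℝ (Fin 4))), ℂ) := ![φa, Complex.I • φb] with hF
  have hFT : ∀ j, IsTimeOrdered (F j) := by
    intro j
    fin_cases j
    · exact hφaT
    · exact (tsupport_smul_subset_right (fun _ : Fin 1 → (EuclideanSpace ℝ (Fin 4)) => Complex.I)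
        (φb : (Fin 1 → (EuclideanSpace ℝ (Fin 4))) → ℂ)).trans hφbT
  have key := hRP 2 (fun _ => 1) (fun _ _ => ()) F hFT
    (fun i j => SchwartzMap.appendTensor (osAdjoint (F i)) (F j))
    (fun i j => isAppendTensorOf_appendTensor _ _)
  obtain ⟨-, him⟩ := key
  simp only [SchwingerFamily.toLabelled_apply] at him
  have him' : (∑ i, ∑ j, S 2 (SchwartzMap.appendTensor (osAdjoint (F i)) (F j))).im = 0 := him
  rw [Fin.sum_univ_two, Fin.sum_univ_two, Fin.sum_univ_two] at him'
  have hF0 : F 0 = φa := rfl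
  have hF1 : F 1 = Complex.I • φb := rfl
  -- the four witnesses in terms of the unscaled pairs
  have h01 : SchwartzMap.appendTensor (osAdjoint (F 0)) (F 1) =
      Complex.I • SchwartzMap.appendTensor (osAdjoint φa) φb := by
    ext y
    simp only [hF0, hF1, SchwartzMap.appendTensor_apply, smul_apply, smul_eq_mul]
    ring
  have h10 : SchwartzMap.appendTensor (osAdjoint (F 1)) (F 0) =
      (-Complex.I) • SchwartzMap.appendTensor (osAdjoint φb) φa := by
    ext y
    simp only [hF0, hF1, SchwartzMap.appendTensor_apply, osAdjoint_apply, smul_apply, smul_eq_mul,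
      map_mul, Complex.conj_I]
    ring
  have h11 : SchwartzMap.appendTensor (osAdjoint (F 1)) (F 1) =
      SchwartzMap.appendTensor (osAdjoint φb) φb := by
    ext y
    simp only [hF1, SchwartzMap.appendTensor_apply, osAdjoint_apply, smul_apply, smul_eq_mul,
      map_mul, Complex.conj_I]
    ring_nf
    rw [Complex.I_sq]
    ring
  have h00 : SchwartzMap.appendTensor (osAdjoint (F 0)) (F 0) =
      SchwartzMap.appendTensor (osAdjoint φa) φa := by rw [hF0]
  rw [h00, h01, h10, h11, map_smul, map_smul, smul_eq_mul, smul_eq_mul] at him'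
  -- the four two-point values
  have eaa := osPair_twoPoint_eq hrep hra hra hβas hβas (fun y => osPair_apply hφa hφa y)
  have ebb := osPair_twoPoint_eq hrep hrb hrb hβbs hβbs (fun y => osPair_apply hφb hφb y)
  obtain ⟨hab, hab'⟩ := osPair_twoPoint hrep hra hrb hβa0 hβb0 hβa1 hβb1 hβas hβbs
    (fun z hz => hK₁ z (lt_trans hz hr1)) (fun y => osPair_apply hφa hφb y)
  obtain ⟨hba, hba'⟩ := osPair_twoPoint hrep hrb hra hβb0 hβa0 hβb1 hβa1 hβbs hβas
    (fun z hz => hK₂ z (lt_trans hz hr2)) (fun y => osPair_apply hφb hφa y)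
  rw [eaa.1, ebb.1] at him'
  simp only [Complex.add_im, Complex.ofReal_im, Complex.mul_im, Complex.I_re, Complex.I_im,
    Complex.neg_re, Complex.neg_im, hab', hba'] at him'
  -- `him'` now says `re 𝔖₂(ab) - re 𝔖₂(ba) = 0`
  have hdiff : (S 2 (SchwartzMap.appendTensor (osAdjoint φa) φb)).re =
      (S 2 (SchwartzMap.appendTensor (osAdjoint φb) φa)).re := by linarith
  rw [abs_sub_comm] at hab
  calc |K (timeReflection 4 a - b) - K (timeReflection 4 b - a)|
      = |(K (timeReflection 4 a - b) - (S 2 (SchwartzMap.appendTensor (osAdjoint φa) φb)).re) +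
          ((S 2 (SchwartzMap.appendTensor (osAdjoint φb) φa)).re - K (timeReflection 4 b - a))| := by
        rw [hdiff]; congr 1; ring
    _ ≤ |K (timeReflection 4 a - b) - (S 2 (SchwartzMap.appendTensor (osAdjoint φa) φb)).re| +
          |(S 2 (SchwartzMap.appendTensor (osAdjoint φb) φa)).re - K (timeReflection 4 b - a)| :=
        abs_add_le _ _
    _ ≤ δ / 2 + δ / 2 := add_le_add hab hba
    _ = δ := by ring


end Summit.QuantumFields.YangMills.Theorems.KernelTransfer

end
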